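import Summits.Ventures.HSemireg.WeilFramePolarisation
import Summits.Ventures.HSemireg.WeilFrameNondegeneracy

/-!
# Venture HSemireg — THEOREM R on the real carriers for a Weil-type abelian `2n`-fold with NO input by value:
# endomorphism `φ` (`φ² = -d`), balanced multiplicity, a `K`-symmetric `(1,1)`-class `h` with `ĥ^{2n} ≠ 0`, non-zero Weil classes

HONEST FRAMING. Part of the Lean index of the computation cell `pub-hsemireg` (seat w3-mod4-1 gen 8, W3 SPECIAL FIBRES,
MOD4-OFFSPLIT §13). The tree's real carriers and Literature layers ONLY: no semiregularity map is constructed; nothing here says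
that HC / HC_CM / HC_AV holds; nothing here is a claim about any explicit variety (the hypotheses — a `φ` with `φ ≫ φ = -(d • 𝟙 A)`
of balanced type, a `K`-symmetric `(1,1)`-class with non-zero top power, non-zero Weil classes — are to be supplied by a
consumer); no Literature fact is declared; NO definition is introduced.

WHAT IS PROVED. `contractionRank_weilType_of_polarisation` (FILE 8) kept ONE input by value: the non-degeneracy `hnd` of the
polarisation 2-vector `ĥ` on `(H^{0,1})^⊥`. By `hnd_of_pow_ne_zero` (FILE 9) it follows from `ĥ^{2n} ≠ 0` in `ΛH¹(A)` — the
non-vanishing of the top divided power of the polarisation («`h^{2n} ≠ 0`, the volume»), since a `K`-symmetric `(1,1)`-class lies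
in `span{ι v · ι l : l ∈ H^{0,1}}`. Hence **`contractionRank_weilType_of_volume`** — THEOREM R on the real carriers for a complex
abelian variety `A` of dimension `2n ≥ 6` with `φ ≫ φ = -(d • 𝟙 A)`, `d ≥ 1`, `P = V₊`, `Q = V₋`, balanced `K`-multiplicity
`p_{i√d} = n`, a class `h ∈ H²(A(ℂ); ℂ)` with `φ^* h = d·h`, of Hodge type `(1,1)`, `ĥ^{2n} ≠ 0`, and NON-ZERO WEIL CLASSES
`c₊ ∈ E₊`, `c₋ ∈ E₋`: if the total class of `κ` is `Σ_{m ≤ 2n} (q_m/m!) ĥ^m + ĉ₊ + ĉ₋`, then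
`contractionRank A κ = 4n² + n²·rank H₂(q) - 2n = (4 + ρ)n² - 2n`. Every hypothesis is a statement in the tree's own vocabulary of
Weil-type abelian varieties (`DegreeOneHodgeTypes`, `WeilClasses`, `IsOfHodgeType`); nothing is taken «in an adapted frame».
Everything PROVED, 0 sorry.
References: [vanGeemen1994HodgeAV] 4.9, Lemma 5.2; [Deligne1982HodgeCycles] §4; [BuchweitzFlenner2008HH] Prop. 6.4.4;
[MumfordAV1970] §1 (4), §4 (iii).
-/

noncomputable section

open CliffordAlgebra (contractLeft)
open ExteriorAlgebra (ι)
open Module CategoryTheory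
open Literature.AlgebraicGeometry.Motives Literature.AlgebraicGeometry.HodgeTheory
open Literature.AlgebraicTopology.SingularHomology

namespace Summit.Ventures.HSemireg.WeilFrame

open Summit.Ventures.HSemireg.Wedge.Hankel

variable {A : AbelianVariety ℂ}

/-- **non-degeneracy of the polarisation 2-vector from its top power, on the real carriers:** for `A` of dimension `2n`,
a `K`-symmetric `(1,1)`-class `h` with `ĥ^{2n} ≠ 0` in `ΛH¹(A)` has `ĥ` non-degenerate on `(H^{0,1})^⊥`.
[cite: BourbakiAlgebre1a3, Ch. III §7 no. 8] [cite: vanGeemen1994HodgeAV, Lemma 5.2] -/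
theorem hnd_of_polarisation_pow_ne_zero (hA : IsSmoothProjective A.dim A.X) {n d : ℕ} (hdim : A.dim = n + n) (hd : 0 < d)
    {φ : A ⟶ A} (hφ : φ ≫ φ = -(d • 𝟙 A)) {P Q : Submodule ℂ (complexBetti A.X 1)}
    (hP : P = Module.End.eigenspace (complexBetti.map φ.hom.hom.hom 1).hom (Complex.I * (Real.sqrt d : ℂ)))
    (hQ : Q = Module.End.eigenspace (complexBetti.map φ.hom.hom.hom 1).hom (-(Complex.I * (Real.sqrt d : ℂ))))
    {h : complexBetti A.X 2} (hh : complexBetti.map φ.hom.hom.hom 2 h = (d : ℂ) • h) (h11 : IsOfHodgeType A.dim A.X 2 1 1 h)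
    (hvol : ((⋀[ℂ]^2 (complexBetti A.X 1)).subtype ((abelianVarietyCohomologyExteriorH1_holds.equiv A 2).symm h)) ^ (n + n) ≠ 0) :
    ∀ l ∈ (hodgeZeroOne hA : Set (complexBetti A.X 1)), ι ℂ l ∈ Submodule.span ℂ
      {y : ExteriorAlgebra ℂ (complexBetti A.X 1) |
        ∃ ψ ∈ {θ : Module.Dual ℂ (complexBetti A.X 1) | ∀ v ∈ hodgeZeroOne hA, θ v = 0}, y = contractLeft ψ
          ((⋀[ℂ]^2 (complexBetti A.X 1)).subtype ((abelianVarietyCohomologyExteriorH1_holds.equiv A 2).symm h))} := by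
  haveI : Module.Finite ℂ (complexBetti A.X 1) := abelianVarietyCohomologyExteriorH1_holds.finite_one A
  have hV : finrank ℂ (complexBetti A.X 1) = (n + n) + (n + n) := by
    rw [Literature.AlgebraicGeometry.Motives.AbelianVariety.finrank_complexBetti_one, hdim]; ring
  have hL : finrank ℂ ↥(hodgeZeroOne hA) = n + n := by rw [AbelianVariety.finrank_hodgeZeroOne_eq_dim A hA, hdim]
  have hΘ := exteriorOf_mem_span_weilGen hA hd hφ hP hQ hh h11
  have hc : ((⋀[ℂ]^2 (complexBetti A.X 1)).subtype ((abelianVarietyCohomologyExteriorH1_holds.equiv A 2).symm h)) ∈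
      Submodule.span ℂ {z : ExteriorAlgebra ℂ (complexBetti A.X 1) |
        ∃ v : complexBetti A.X 1, ∃ q ∈ (hodgeZeroOne hA : Set (complexBetti A.X 1)), z = ι ℂ v * ι ℂ q} := by
    refine Submodule.span_mono ?_ hΘ
    rintro _ ⟨x, l, hxl, rfl⟩
    rcases hxl with ⟨-, hl⟩ | ⟨-, hl⟩
    · exact ⟨x, l, hl.1, rfl⟩
    · exact ⟨x, l, hl.1, rfl⟩
  exact hnd_of_pow_ne_zero hV (hodgeZeroOne hA) hL hc hvol

/-- **THEOREM R on the real carriers for Weil type `(n, n)` — NO input by value** (`n ≥ 3`): `A` a complex abelian variety of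
dimension `2n`; `φ : A ⟶ A`, `φ ≫ φ = -(d • 𝟙 A)`, `d ≥ 1`; `P = V₊`, `Q = V₋` the `± i√d`-eigenspaces of `φ^*` on `H¹(A; ℂ)`;
balanced `K`-multiplicity `p_{i√d} = dim (P ∩ H^{1,0}) = n`; a class `h ∈ H²(A(ℂ); ℂ)` with `φ^* h = d·h` (K-symmetric), of
Hodge type `(1,1)`, and `ĥ^{2n} ≠ 0` in `ΛH¹` (`ĥ = (equiv A 2)⁻¹ h`); NON-ZERO WEIL CLASSES `c₊ ∈ weilClassesPlus A φ n d`,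
`c₋ ∈ weilClassesMinus A φ n d`; and the total class of `κ` equal to `Σ_{m ≤ 2n} (q_m/m!) ĥ^m + ĉ₊ + ĉ₋`. Then
`contractionRank A κ = 4n² + n²·rank H₂(q) - 2n = (4 + ρ)n² - 2n`.
[cite: vanGeemen1994HodgeAV, 4.9 and Lemma 5.2] [cite: BuchweitzFlenner2008HH, Prop. 6.4.4] [cite: MumfordAV1970, §1 (4) and §4 (iii)] -/
theorem contractionRank_weilType_of_volume (hA : IsSmoothProjective A.dim A.X)
    (κ : ∀ p : ℕ, complexBetti A.X (2 * p)) {n d : ℕ} (hn : 3 ≤ n) (hdim : A.dim = n + n) (hd : 0 < d) {φ : A ⟶ A}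
    (hφ : φ ≫ φ = -(d • 𝟙 A)) {P Q : Submodule ℂ (complexBetti A.X 1)}
    (hP : P = Module.End.eigenspace (complexBetti.map φ.hom.hom.hom 1).hom (Complex.I * (Real.sqrt d : ℂ)))
    (hQ : Q = Module.End.eigenspace (complexBetti.map φ.hom.hom.hom 1).hom (-(Complex.I * (Real.sqrt d : ℂ))))
    (hp : finrank ℂ ↥(P ⊓ hodgeOneZero hA) = n) {h : complexBetti A.X 2}
    (hh : complexBetti.map φ.hom.hom.hom 2 h = (d : ℂ) • h) (h11 : IsOfHodgeType A.dim A.X 2 1 1 h)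
    (hvol : ((⋀[ℂ]^2 (complexBetti A.X 1)).subtype ((abelianVarietyCohomologyExteriorH1_holds.equiv A 2).symm h)) ^ (n + n) ≠ 0)
    {cP cQ : complexBetti A.X (2 * n)} (hcP : cP ∈ weilClassesPlus A φ n d) (hcP0 : cP ≠ 0)
    (hcQ : cQ ∈ weilClassesMinus A φ n d) (hcQ0 : cQ ≠ 0) (q : ℕ → ℂ)
    (hx : totalExteriorClass A κ = (∑ m ∈ Finset.range (n + n + 1), (q m * ((m.factorial : ℕ) : ℂ)⁻¹) •
        ((⋀[ℂ]^2 (complexBetti A.X 1)).subtype ((abelianVarietyCohomologyExteriorH1_holds.equiv A 2).symm h)) ^ m) +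
      (⋀[ℂ]^(2 * n) (complexBetti A.X 1)).subtype ((abelianVarietyCohomologyExteriorH1_holds.equiv A (2 * n)).symm cP) +
      (⋀[ℂ]^(2 * n) (complexBetti A.X 1)).subtype ((abelianVarietyCohomologyExteriorH1_holds.equiv A (2 * n)).symm cQ)) :
    contractionRank A κ = ((4 * (n * n) + n * n * (hankel1 ℂ (n + n) 2 q).rank - 2 * n : ℕ) : Cardinal) :=
  contractionRank_weilType_of_polarisation hA κ hn hdim hd hφ hP hQ hp hh h11
    (hnd_of_polarisation_pow_ne_zero hA hdim hd hφ hP hQ hh h11 hvol) hcP hcP0 hcQ hcQ0 q hx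

end Summit.Ventures.HSemireg.WeilFrame

end
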